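import Summits.QuantumFields.YangMills.Theorems.BalabanLadderIRcofTemporalTwistSubadditivity
import Literature.MathematicalPhysics.QuantumFieldTheory.WilsonFinTorusTwistedPartitionDomination
import Literature.MathematicalPhysics.QuantumFieldTheory.WilsonFinTorusTwistedPartitionSwap
import Literature.MathematicalPhysics.QuantumFieldTheory.WilsonFinTorusMagneticFluxSectors
import Literature.MathematicalPhysics.QuantumFieldTheory.WilsonFinTorusFluxEnergies
import HarnessLib

/-!
# TEMPORAL GROWTH OF LIGHT TWISTS under neutral diluteness (Perron–Frobenius ordering of 't Hooft flux sectors; no flux gap)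

Helper for crux `IRcof` (stmt-QuantumFields-26930), census sub-row 21c — §1c (the located lemma, PROVED, def-free) of ideator ym-ir-idea-23 g0's
LINE 1′ «meso-vortex-growth» (`Cruxes/IRcof/Lines/meso_vortex_growth.lean` rev 2 bb358415fa8f ∕ sha12 db279007bb97; critic of record ym-ir-crit-3 g4
VERDICT 21:26:45Z PASS-WITH-PRICE, KEY «GO, one helper: LAND §1c DEF-FREE … as Theorems/BalabanLadderIRcofTemporalTwistGrowth.lean»), extracted VERBATIM by
the custody LEAD ym-ir-line-ab-p1 g7 (LEAD LANE PROTOCOL (b)); mathematics unchanged; namespace moved to `…Cruxes.IRcof.TemporalTwistGrowth` so that the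
Lines module (ns `…MesoVortexGrowth`, §2–§5 with the priced constants NOT landed) can import this file without a duplicate-declaration break before its re-cut.

CONTENT (every compact `G`, continuous unitary `ρ`, `β ≥ 0`, any finite abelian group `Γ` of central temporal twists `φ` of a spatial box; no simplicity,
no floor, no unit map, no definition):
* `exists_vacuumLevel` — packaging of the tree's flux-sector spectral data: `λ₀ > 0` with the vacuum lower bound `λ₀^m·λ₀² ≤ Re Z_0(m+2)` and the
  one-step sector decay `Re Z_ψ(m+3) ≤ λ₀ · Re Z_ψ(m+2)` for every flux `ψ` (Perron–Frobenius ORDERING `Λ_ψ ≤ λ₀`).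
* `addChar_re_le_one` — `Re ψ(x) ≤ 1` for a character of a finite abelian group.
* ★ `twistCost_le_of_le_of_neutralDilute` — if `Z(b; M+2) − Z^{(φ k)}(b; M+2) ≤ θ·Z(b; M+2)` and the box is NEUTRALLY DILUTE at time `M+2`
  (`Z(b; M+2) ≤ 𝒩·λ₀^{M+2}`), then `Z − Z^{(φ k)} ≤ θ·𝒩·Z` at EVERY later time: Fourier inversion over flux sectors
  (`sum_apply_mul_wilsonFinTorusFluxPartition`), sector decay, vacuum lower bound (`le_re_fluxSector_zero`).  Bounded GROWTH needs PF ordering + bounded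
  effective degeneracy `𝒩`, NOT a flux gap (decay would need the gap); the critic's B2 counter-model is the `𝒩 = 401` case.

HONEST FRAMING: group-blind partition-function bookkeeping (width 0); the priced obligation Props (M_T) ∕ (ND) ∕ (V) ∕ (CF) and their constants are NOT here;
nothing proves N_cof, PXcof, `IRcof`, `IR`, or the Clay Yang–Mills mass gap (NOT proved anywhere in this tree; R4 = `BalabanLadder.UV` only).  Attribution:
ym-ir-idea-23 g0 (author).
-/

set_option autoImplicit false

noncomputable section

open Filter Topology MeasureTheory Function Finset
open scoped BigOperators ComplexConjugate ENNReal
open Literature.Analysis.OperatorTheory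
open Literature.MathematicalPhysics.QuantumFieldTheory Literature.MathematicalPhysics.QuantumLattice
open Summit.QuantumFields.YangMills.Cruxes.IRcof.TemporalTwistSubadditivity

namespace Summit.QuantumFields.YangMills.Cruxes.IRcof.TemporalTwistGrowth

section Growth

variable {G : Type} [Group G] [TopologicalSpace G] [IsTopologicalGroup G] [CompactSpace G]
  [MeasurableSpace G] [BorelSpace G] [SecondCountableTopology G] {N : ℕ} (ρ : G →* Matrix (Fin N) (Fin N) ℂ)
  {Γ : Type*} [AddCommGroup Γ] [Fintype Γ]

/-- **The vacuum level of the box** (packaging of the tree's spectral data): there is `λ₀ > 0` (the norm of the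
transfer operator of the spatial box `b₁ × b₂ × b₃`) with the VACUUM LOWER BOUND `λ₀^m·λ₀² ≤ Re Z_0(m+2)` and the
ONE-STEP SECTOR DECAY `Re Z_ψ(m+3) ≤ λ₀ · Re Z_ψ(m+2)` for EVERY flux `ψ` (Perron–Frobenius ordering `Λ_ψ ≤ λ₀` of the
sector tops). -/
theorem exists_vacuumLevel (hρ : Continuous ρ) (hρu : ∀ g, ρ g ∈ Matrix.unitaryGroup (Fin N) ℂ)
    {β : ℝ} (hβ : 0 ≤ β) {φ : Γ → Fin 4 → G} (hφ0 : φ 0 = 1) (hφadd : ∀ k k', φ (k + k') = φ k * φ k')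
    (hφc : ∀ k (i : Fin 3), φ k i.castSucc ∈ Subgroup.center G) (b₁ b₂ b₃ : ℕ) :
    ∃ lam₀ : ℝ, 0 < lam₀ ∧
      (∀ m : ℕ, lam₀ ^ m * lam₀ ^ 2 ≤ (wilsonFinTorusFluxPartition ρ β φ 0 b₁ b₂ b₃ (m + 2)).re) ∧
      (∀ (ψ : AddChar Γ ℂ) (m : ℕ), (wilsonFinTorusFluxPartition ρ β φ ψ b₁ b₂ b₃ (m + 1 + 2)).re ≤
          lam₀ * (wilsonFinTorusFluxPartition ρ β φ ψ b₁ b₂ b₃ (m + 2)).re) := by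
  haveI : IsFiniteMeasure (haarProbability G) := by
    dsimp [haarProbability]; infer_instance
  obtain ⟨C, A, s, hcnt, b, lam, i₀, hC, hA, hb, hlam, hi₀, hL0⟩ :=
    exists_eigenbasis_finTorusSliceKernel hρ hρu hβ b₁ b₂ b₃
  haveI : Countable s := hcnt
  have hK := stronglyMeasurable_uncurry_finTorusSliceKernel (b₁ := b₁) (b₂ := b₂) (b₃ := b₃) ρ hρ β
  have hsymm : ∀ x y : FinSpatialSite b₁ b₂ b₃ × Fin 3 → G,
      finTorusSliceKernel ρ β x y = finTorusSliceKernel ρ β y x := finTorusSliceKernel_symm ρ hρu β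
  have hKpos : ∀ x y : FinSpatialSite b₁ b₂ b₃ × Fin 3 → G, 0 < finTorusSliceKernel ρ β x y :=
    finTorusSliceKernel_pos ρ hρ β
  have hT0 : (finSliceTwist (φ 0) : (FinSpatialSite b₁ b₂ b₃ × Fin 3 → G) → _) = id := by
    rw [hφ0]; exact finSliceTwist_one
  have hTadd : ∀ (k k' : Γ) (x : FinSpatialSite b₁ b₂ b₃ × Fin 3 → G),
      finSliceTwist (φ (k + k')) x = finSliceTwist (φ k) (finSliceTwist (φ k') x) := fun k k' x => by
    rw [finSliceTwist_finSliceTwist, hφadd]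
  have hT : ∀ k : Γ, MeasurePreserving (finSliceTwist (φ k) : (FinSpatialSite b₁ b₂ b₃ × Fin 3 → G) → _)
      (Measure.pi fun _ => haarProbability G) (Measure.pi fun _ => haarProbability G) :=
    fun k => measurePreserving_finSliceTwist (φ k)
  have hKT : ∀ (k : Γ) (x y : FinSpatialSite b₁ b₂ b₃ × Fin 3 → G),
      finTorusSliceKernel ρ β (finSliceTwist (φ k) x) (finSliceTwist (φ k) y) = finTorusSliceKernel ρ β x y :=
    fun k x y => finTorusSliceKernel_finSliceTwist ρ (hφc k) β x y
  have hz : ∀ (k : Γ) (M : ℕ), (fun k n => wilsonFinTorusTwistedPartition ρ β (φ k) b₁ b₂ b₃ n) k (M + 2) =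
      ∫ x, ((fun f : (FinSpatialSite b₁ b₂ b₃ × Fin 3 → G) → ℝ => fun w =>
            ∫ y, finTorusSliceKernel ρ β w y * f y
              ∂(Measure.pi fun _ : FinSpatialSite b₁ b₂ b₃ × Fin 3 => haarProbability G))^[M + 1]
          (fun y => finTorusSliceKernel ρ β y x)) (finSliceTwist (φ k) x)
        ∂(Measure.pi fun _ : FinSpatialSite b₁ b₂ b₃ × Fin 3 => haarProbability G) :=
    fun k M => wilsonFinTorusTwistedPartition_eq_integral_iterate ρ hρ β (hφc k) b₁ b₂ b₃ M
  have hlam0 : ∀ i, 0 ≤ lam i := fun i => (hlam i).1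
  refine ⟨lam i₀, lt_of_le_of_ne (hlam0 i₀) (Ne.symm hL0), fun m => ?_, fun ψ m => ?_⟩
  · exact le_re_fluxSector_zero (T := fun k => finSliceTwist (φ k)) hK hC hsymm hKpos hA hb hlam0 hi₀ hL0 hT hT0
      hTadd hKT hz m
  · have h1 := re_fluxSector_succ_le_fluxTop_mul (T := fun k => finSliceTwist (φ k)) hK hC hsymm hA hb hlam0 hT hT0
      hTadd hz ψ m
    have h2 := (fluxSector_nonneg (T := fun k => finSliceTwist (φ k)) hK hC hsymm hA hb hlam0 hT hT0 hTadd hz ψ m).1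
    exact h1.trans (mul_le_mul_of_nonneg_right (fluxTop_le_top hb hi₀ ψ) h2)

/-- `Re ψ(k) ≤ 1` for an additive character of a finite abelian group (its values are unimodular). -/
theorem addChar_re_le_one (ψ : AddChar Γ ℂ) (x : Γ) : (ψ x).re ≤ 1 := by
  have h' : ((Complex.normSq (ψ x) : ℝ) : ℂ) = 1 := by
    rw [Complex.normSq_eq_conj_mul_self, ← AddChar.map_neg_eq_conj, ← AddChar.map_add_eq_mul, neg_add_cancel,
      AddChar.map_zero_eq_one]
  have h : Complex.normSq (ψ x) = 1 := by exact_mod_cast h'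
  rw [Complex.normSq_apply] at h
  nlinarith [sq_nonneg ((ψ x).im), sq_nonneg ((ψ x).re - 1)]

/-- ★ **TEMPORAL GROWTH OF LIGHT TWISTS under neutral diluteness** (the located lemma of the line).  For `β ≥ 0`,
continuous unitary `ρ`, ANY compact `G`, any finite abelian group `Γ` of central temporal twists `φ` of the box
`b₁ × b₂ × b₃ × ·` and any `k ∈ Γ`: if the twist `φ k` costs at most `θ·Z` at Euclidean time `M + 2`, and the box is
NEUTRALLY DILUTE at that time with constant `𝒩` — `Z(M+2) ≤ 𝒩 · λ₀^{M+2}` for the vacuum level `λ₀` (stated for every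
`λ₀ > 0` obeying the two inequalities that pin `λ₀ = ‖𝕋‖`: `λ₀^{m+2} ≤ Z(m+2)` and `Z(m+3) ≤ λ₀ Z(m+2)`) — then the
twist costs at most `θ·𝒩·Z` at EVERY later time `M' + 2`.  Mechanism: `Z − Z^{(φ k)} = Σ_ψ (1 − Re ψ(k)) Re Z_ψ`
(Fourier inversion over 't Hooft's flux sectors), each sector decays at least as fast as the vacuum level
(`Re Z_ψ(m+3) ≤ λ₀ Re Z_ψ(m+2)`, Perron–Frobenius ORDERING — no gap needed), and `Z(M'+2) ≥ λ₀^{M'+2}`. -/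
theorem twistCost_le_of_le_of_neutralDilute (hρ : Continuous ρ) (hρu : ∀ g, ρ g ∈ Matrix.unitaryGroup (Fin N) ℂ)
    {β : ℝ} (hβ : 0 ≤ β) {φ : Γ → Fin 4 → G} (hφ0 : φ 0 = 1) (hφadd : ∀ k k', φ (k + k') = φ k * φ k')
    (hφc : ∀ k (i : Fin 3), φ k i.castSucc ∈ Subgroup.center G) (b₁ b₂ b₃ : ℕ) (k : Γ) {θ 𝒩 : ℝ} (hθ : 0 ≤ θ)
    {M M' : ℕ} (hMM' : M ≤ M')
    (hND : ∀ lam₀ : ℝ, 0 < lam₀ →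
      (∀ m : ℕ, lam₀ ^ (m + 2) ≤ wilsonFinTorusPartition ρ β b₁ b₂ b₃ (m + 2)) →
      (∀ m : ℕ, wilsonFinTorusPartition ρ β b₁ b₂ b₃ (m + 1 + 2) ≤ lam₀ * wilsonFinTorusPartition ρ β b₁ b₂ b₃ (m + 2)) →
      wilsonFinTorusPartition ρ β b₁ b₂ b₃ (M + 2) ≤ 𝒩 * lam₀ ^ (M + 2))
    (hcost : wilsonFinTorusPartition ρ β b₁ b₂ b₃ (M + 2) - wilsonFinTorusTwistedPartition ρ β (φ k) b₁ b₂ b₃ (M + 2) ≤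
      θ * wilsonFinTorusPartition ρ β b₁ b₂ b₃ (M + 2)) :
    wilsonFinTorusPartition ρ β b₁ b₂ b₃ (M' + 2) - wilsonFinTorusTwistedPartition ρ β (φ k) b₁ b₂ b₃ (M' + 2) ≤
      θ * 𝒩 * wilsonFinTorusPartition ρ β b₁ b₂ b₃ (M' + 2) := by
  obtain ⟨lam₀, hlam₀, hvac, hdec⟩ := exists_vacuumLevel ρ hρ hρu hβ hφ0 hφadd hφc b₁ b₂ b₃
  -- notation
  set Zs : AddChar Γ ℂ → ℕ → ℝ := fun ψ n => (wilsonFinTorusFluxPartition ρ β φ ψ b₁ b₂ b₃ n).re with hZs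
  have hnonneg : ∀ ψ m, 0 ≤ Zs ψ (m + 2) := fun ψ m =>
    (wilsonFinTorusFluxPartition_nonneg ρ hρ hρu hβ hφ0 hφadd hφc ψ b₁ b₂ b₃ m).1
  have him : ∀ ψ m, (wilsonFinTorusFluxPartition ρ β φ ψ b₁ b₂ b₃ (m + 2)).im = 0 := fun ψ m =>
    (wilsonFinTorusFluxPartition_nonneg ρ hρ hρu hβ hφ0 hφadd hφc ψ b₁ b₂ b₃ m).2
  -- `Z(m+2) = Σ_ψ Re Z_ψ(m+2)`
  have hZsum : ∀ m, wilsonFinTorusPartition ρ β b₁ b₂ b₃ (m + 2) = ∑ ψ, Zs ψ (m + 2) := fun m => by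
    have h := congrArg Complex.re (sum_wilsonFinTorusFluxPartition ρ β hφ0 b₁ b₂ b₃ (m + 2))
    rw [Complex.re_sum, Complex.ofReal_re] at h
    exact h.symm
  -- `Z^{(φ k)}(m+2) = Σ_ψ Re ψ(k) · Re Z_ψ(m+2)`
  have hWsum : ∀ m, wilsonFinTorusTwistedPartition ρ β (φ k) b₁ b₂ b₃ (m + 2) = ∑ ψ, (ψ k).re * Zs ψ (m + 2) :=
    fun m => by
    have h := congrArg Complex.re (sum_apply_mul_wilsonFinTorusFluxPartition ρ β φ b₁ b₂ b₃ (m + 2) k)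
    rw [Complex.re_sum, Complex.ofReal_re] at h
    rw [← h]
    refine Finset.sum_congr rfl fun ψ _ => ?_
    rw [Complex.mul_re, him ψ m, mul_zero, sub_zero]
  -- the cost as a positive combination of sectors
  have hcost_eq : ∀ m, wilsonFinTorusPartition ρ β b₁ b₂ b₃ (m + 2) -
      wilsonFinTorusTwistedPartition ρ β (φ k) b₁ b₂ b₃ (m + 2) = ∑ ψ, (1 - (ψ k).re) * Zs ψ (m + 2) := fun m => by
    rw [hZsum m, hWsum m, ← Finset.sum_sub_distrib]
    refine Finset.sum_congr rfl fun ψ _ => ?_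
    ring
  -- one-step decay of the cost
  have hstep : ∀ m, wilsonFinTorusPartition ρ β b₁ b₂ b₃ (m + 1 + 2) -
      wilsonFinTorusTwistedPartition ρ β (φ k) b₁ b₂ b₃ (m + 1 + 2) ≤
      lam₀ * (wilsonFinTorusPartition ρ β b₁ b₂ b₃ (m + 2) -
        wilsonFinTorusTwistedPartition ρ β (φ k) b₁ b₂ b₃ (m + 2)) := fun m => by
    rw [hcost_eq (m + 1), hcost_eq m, Finset.mul_sum]
    refine Finset.sum_le_sum fun ψ _ => ?_
    have h1 : 0 ≤ 1 - (ψ k).re := sub_nonneg.2 (addChar_re_le_one ψ k)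
    have h2 : Zs ψ (m + 1 + 2) ≤ lam₀ * Zs ψ (m + 2) := hdec ψ m
    calc (1 - (ψ k).re) * Zs ψ (m + 1 + 2) ≤ (1 - (ψ k).re) * (lam₀ * Zs ψ (m + 2)) :=
          mul_le_mul_of_nonneg_left h2 h1
      _ = lam₀ * ((1 - (ψ k).re) * Zs ψ (m + 2)) := by ring
  -- iterate
  have hiter : ∀ d m, wilsonFinTorusPartition ρ β b₁ b₂ b₃ (m + d + 2) -
      wilsonFinTorusTwistedPartition ρ β (φ k) b₁ b₂ b₃ (m + d + 2) ≤
      lam₀ ^ d * (wilsonFinTorusPartition ρ β b₁ b₂ b₃ (m + 2) -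
        wilsonFinTorusTwistedPartition ρ β (φ k) b₁ b₂ b₃ (m + 2)) := by
    intro d
    induction d with
    | zero => intro m; simp
    | succ d ih =>
      intro m
      have h1 := hstep (m + d)
      have h2 := ih m
      have e1 : m + (d + 1) + 2 = m + d + 1 + 2 := by ring
      rw [e1]
      calc _ ≤ lam₀ * (wilsonFinTorusPartition ρ β b₁ b₂ b₃ (m + d + 2) -
              wilsonFinTorusTwistedPartition ρ β (φ k) b₁ b₂ b₃ (m + d + 2)) := h1
        _ ≤ lam₀ * (lam₀ ^ d * (wilsonFinTorusPartition ρ β b₁ b₂ b₃ (m + 2) -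
              wilsonFinTorusTwistedPartition ρ β (φ k) b₁ b₂ b₃ (m + 2))) :=
            mul_le_mul_of_nonneg_left h2 hlam₀.le
        _ = lam₀ ^ (d + 1) * _ := by ring
  -- Z-level consequences of the vacuum data
  have hvacZ : ∀ m, lam₀ ^ (m + 2) ≤ wilsonFinTorusPartition ρ β b₁ b₂ b₃ (m + 2) := fun m => by
    have h1 := hvac m
    have h2 := re_wilsonFinTorusFluxPartition_le ρ hρ hρu hβ hφ0 hφadd hφc (0 : AddChar Γ ℂ) b₁ b₂ b₃ m
    rw [pow_add]; exact h1.trans h2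
  have hdecZ : ∀ m, wilsonFinTorusPartition ρ β b₁ b₂ b₃ (m + 1 + 2) ≤
      lam₀ * wilsonFinTorusPartition ρ β b₁ b₂ b₃ (m + 2) := fun m => by
    rw [hZsum (m + 1), hZsum m, Finset.mul_sum]
    exact Finset.sum_le_sum fun ψ _ => hdec ψ m
  have hN := hND lam₀ hlam₀ hvacZ hdecZ
  -- assemble
  obtain ⟨d, rfl⟩ := Nat.exists_eq_add_of_le hMM'
  have hZ'low := hvacZ (M + d)
  have h𝒩 : 0 ≤ 𝒩 := by
    have hZpos : 0 < wilsonFinTorusPartition ρ β b₁ b₂ b₃ (M + 2) := lt_of_lt_of_le (by positivity) (hvacZ M)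
    have : 0 < 𝒩 * lam₀ ^ (M + 2) := lt_of_lt_of_le hZpos hN
    exact (pos_of_mul_pos_left this (by positivity) |>.le)  -- hmm
  calc wilsonFinTorusPartition ρ β b₁ b₂ b₃ (M + d + 2) -
        wilsonFinTorusTwistedPartition ρ β (φ k) b₁ b₂ b₃ (M + d + 2)
      ≤ lam₀ ^ d * (wilsonFinTorusPartition ρ β b₁ b₂ b₃ (M + 2) -
          wilsonFinTorusTwistedPartition ρ β (φ k) b₁ b₂ b₃ (M + 2)) := hiter d M
    _ ≤ lam₀ ^ d * (θ * wilsonFinTorusPartition ρ β b₁ b₂ b₃ (M + 2)) :=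
          mul_le_mul_of_nonneg_left hcost (by positivity)
    _ ≤ lam₀ ^ d * (θ * (𝒩 * lam₀ ^ (M + 2))) :=
          mul_le_mul_of_nonneg_left (mul_le_mul_of_nonneg_left hN hθ) (by positivity)
    _ = θ * 𝒩 * lam₀ ^ (M + d + 2) := by ring
    _ ≤ θ * 𝒩 * wilsonFinTorusPartition ρ β b₁ b₂ b₃ (M + d + 2) :=
          mul_le_mul_of_nonneg_left hZ'low (mul_nonneg hθ h𝒩)


/-! ### APPEND (rev 3 of the Lines file, crit-3 g4 price P1): FLUX-PROJECTED neutral diluteness — two more PROVED, def-free lemmas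
(`partition_le_two_mul_proj`: all-twist lightness `θ̄ ≤ 1/2` gives `Z ≤ 2·|Γ|⁻¹Σ_k Z^{(φ k)}`; ★ `twistCost_le_of_light_of_projDilute`: the growth
lemma under the PROJECTED diluteness `|Γ|⁻¹Σ_k Z^{(φ k)}(M+2) ≤ 𝒩 λ₀^{M+2}`, factor `2𝒩` — no electric-flux sector is asked to be suppressed).
Same honest framing: width 0, nothing toward either wall; author ym-ir-idea-23 g0. -/

/-- **All-twist lightness controls the full partition function by the flux-PROJECTED one** (crit-3 g4 P1): if EVERY member of the twist
family costs at most `θ̄·Z` at some time `t` and `θ̄ ≤ 1/2`, then `Z(t) ≤ 2 · |Γ|⁻¹ Σ_k Z^{(φ k)}(t)` — the electric-flux sectors `ψ ≠ 0`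
carry at most the fraction `θ̄` of `Z` (`Σ_k (Z − Z^{(φ k)}) = |Γ| Σ_{ψ≠0} Re Z_ψ`), so the neutral (flux-projected) partition function
`|Γ|⁻¹ Σ_k Z^{(φ k)} = Re Z_{ψ=0}` is at least `(1 − θ̄)·Z`. -/
theorem partition_le_two_mul_proj (hρ : Continuous ρ) (β : ℝ) (φ : Γ → Fin 4 → G) (b₁ b₂ b₃ t : ℕ) {θ : ℝ} (hθ2 : θ ≤ 1 / 2)
    (hall : ∀ k : Γ, wilsonFinTorusPartition ρ β b₁ b₂ b₃ t - wilsonFinTorusTwistedPartition ρ β (φ k) b₁ b₂ b₃ t ≤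
      θ * wilsonFinTorusPartition ρ β b₁ b₂ b₃ t) :
    wilsonFinTorusPartition ρ β b₁ b₂ b₃ t ≤
      2 * ((Fintype.card Γ : ℝ)⁻¹ * ∑ k : Γ, wilsonFinTorusTwistedPartition ρ β (φ k) b₁ b₂ b₃ t) := by
  have hc : (0 : ℝ) < Fintype.card Γ := by exact_mod_cast (Fintype.card_pos : 0 < Fintype.card Γ)
  have hZ : 0 < wilsonFinTorusPartition ρ β b₁ b₂ b₃ t := wilsonFinTorusPartition_pos hρ β b₁ b₂ b₃ t
  have hsum := Finset.sum_le_sum fun k (_ : k ∈ (Finset.univ : Finset Γ)) => hall k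
  simp only [Finset.sum_sub_distrib, Finset.sum_const, Finset.card_univ, nsmul_eq_mul] at hsum
  rw [show 2 * ((Fintype.card Γ : ℝ)⁻¹ * ∑ k : Γ, wilsonFinTorusTwistedPartition ρ β (φ k) b₁ b₂ b₃ t) =
      2 * (∑ k : Γ, wilsonFinTorusTwistedPartition ρ β (φ k) b₁ b₂ b₃ t) / (Fintype.card Γ : ℝ) by ring, le_div_iff₀ hc]
  nlinarith [mul_le_mul_of_nonneg_right hθ2 (mul_nonneg hc.le hZ.le)]

/-- ★ **TEMPORAL GROWTH under FLUX-PROJECTED neutral diluteness (crit-3 g4 P1; PROVED).**  As `twistCost_le_of_le_of_neutralDilute`, but the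
diluteness hypothesis bounds only the NEUTRAL (flux-projected) partition function `|Γ|⁻¹ Σ_k Z^{(φ k)}(M+2) ≤ 𝒩 λ₀^{M+2}` — no electric-flux
sector is asked to be suppressed — at the price that ALL members of the family are `θ`-light at time `M + 2` with `θ ≤ 1/2`; the growth factor
becomes `2𝒩`. -/
theorem twistCost_le_of_light_of_projDilute (hρ : Continuous ρ) (hρu : ∀ g, ρ g ∈ Matrix.unitaryGroup (Fin N) ℂ)
    {β : ℝ} (hβ : 0 ≤ β) {φ : Γ → Fin 4 → G} (hφ0 : φ 0 = 1) (hφadd : ∀ k k', φ (k + k') = φ k * φ k')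
    (hφc : ∀ k (i : Fin 3), φ k i.castSucc ∈ Subgroup.center G) (b₁ b₂ b₃ : ℕ) {θ 𝒩 : ℝ} (hθ : 0 ≤ θ) (hθ2 : θ ≤ 1 / 2)
    {M M' : ℕ} (hMM' : M ≤ M')
    (hNDp : ∀ lam₀ : ℝ, 0 < lam₀ →
      (∀ m : ℕ, lam₀ ^ (m + 2) ≤ wilsonFinTorusPartition ρ β b₁ b₂ b₃ (m + 2)) →
      (∀ m : ℕ, wilsonFinTorusPartition ρ β b₁ b₂ b₃ (m + 1 + 2) ≤ lam₀ * wilsonFinTorusPartition ρ β b₁ b₂ b₃ (m + 2)) →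
      (Fintype.card Γ : ℝ)⁻¹ * ∑ k : Γ, wilsonFinTorusTwistedPartition ρ β (φ k) b₁ b₂ b₃ (M + 2) ≤ 𝒩 * lam₀ ^ (M + 2))
    (hall : ∀ k : Γ, wilsonFinTorusPartition ρ β b₁ b₂ b₃ (M + 2) - wilsonFinTorusTwistedPartition ρ β (φ k) b₁ b₂ b₃ (M + 2) ≤
      θ * wilsonFinTorusPartition ρ β b₁ b₂ b₃ (M + 2)) (k : Γ) :
    wilsonFinTorusPartition ρ β b₁ b₂ b₃ (M' + 2) - wilsonFinTorusTwistedPartition ρ β (φ k) b₁ b₂ b₃ (M' + 2) ≤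
      θ * (2 * 𝒩) * wilsonFinTorusPartition ρ β b₁ b₂ b₃ (M' + 2) :=
  twistCost_le_of_le_of_neutralDilute ρ hρ hρu hβ hφ0 hφadd hφc b₁ b₂ b₃ k hθ hMM'
    (fun lam₀ hlam₀ hvac hdec => (partition_le_two_mul_proj ρ hρ β φ b₁ b₂ b₃ (M + 2) hθ2 hall).trans
      (by nlinarith [hNDp lam₀ hlam₀ hvac hdec]))
    (hall k)

end Growth

end Summit.QuantumFields.YangMills.Cruxes.IRcof.TemporalTwistGrowth

end
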